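import Summits.MatrixMultiplication.OmegaCensus.LocalUSPChartBound
import Literature.Computability.AlgebraicComplexity.USPCapacityLowerBound
import Mathlib.Analysis.SpecialFunctions.Log.Base
import HarnessLib

/-!
# ω-census, family (b1-U): CKSU's `ω < 2.41` through the GROUP-THEORETIC route, in the kernel
(USP capacity `3/2^{2/3}` + the Coppersmith–Winograd chart, Thm. 37 + Thm. 5.5)

HONEST FRAMING (pub-omega census; verbatim): lottery ticket; floor = certified bounds/negative ranges.
Census BOOKKEEPING for the group-theoretic family (census row R26, "Thm 37 + CW USP, `2.4036322608…`",
hitherto an engine value ×2/×3), not progress on `ω`: the tree proves the same number by the laser method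
(`Literature/…/CwEasyOmegaBound.lean`, `omega_le_logb_eight`) and `ω < 2.373` (`LeGall2014_cw4`).  What is
new here is the DERIVATION: Cohn–Kleinberg–Szegedy–Umans 2005, §6.2–6.3 (arXiv:math/0511460 p. 11), AS
PRINTED — "Together with the example above [the `Cyc_ℓ`-chart], this theorem [Thm. 37] gives an analogue of
Theorem 33 for local USPs. Using Theorem 13 [the USP capacity `3/2^{2/3}`, Coppersmith–Winograd], this
example achieves `ω < 2.41`." — now a kernel theorem assembled from tree-PROVED parts only:

* `exists_localUSP_card_ge_pow` (`Literature/…/USPCapacityLowerBound.lean`): local USPs of width `k` with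
  `≥ C^k` rows for every `C < 3/2^{2/3}` (Coppersmith–Winograd's construction via the tree's free-diagonal
  theorem);
* `omega_le_of_isLocalUSP` (`LocalUSPChartBound.lean`): a local USP of `s` rows and width `k` gives, through
  the CW chart, CKSU Thm. 37 (`CohnKleinbergSzegedyUmans2005_thm37`) and Thm. 5.5
  (`CohnKleinbergSzegedyUmans2005_5_5_abelian_holds`), `ω ≤ 3 (k log m − log s)/(k log(m − 2))`, `m ≥ 4`.

Results:
* `omega_le_of_localUSP_rate` — `ω ≤ 3 (log m − log C)/log(m − 2)` for every `0 < C < 3/2^{2/3}`, `m ≥ 4`;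
* `omega_le_cksu_uspChart` — the limit `C → 3/2^{2/3}`: **`ω ≤ 3 (log m − log(3/2^{2/3}))/log(m − 2)`**;
* `omega_le_cksu_uspChart_ten` — `m = 10`: **`ω ≤ 3 (log 10 − log(3/2^{2/3}))/log 8`** (`= log₈(4000/27)
  = 2.4036322608…`, the census value R26; `(10 · 2^{2/3}/3)³ = 4000/27`);
* `omega_le_cksu_chart_decimal : ω ≤ 2.4037`, by the integer comparison `4000^10000 < 27^10000 · 8^24037`.
The statements `ω ≤ log₈(4000/27)` and `ω < 2.41` THEMSELVES are already tree theorems by the laser route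
(`omega_le_logb_eight`, `BCS1997_cor1543` in `CwEasyOmegaBound.lean`) and are not re-declared here (gate
dedup); this file supplies CKSU's group-theoretic DERIVATION of the same number.

References: Cohn–Kleinberg–Szegedy–Umans, FOCS 2005 (arXiv:math/0511460) §3 Thm. 13, §6.2 Def. 36 / Thm. 37
and the sentence "this example achieves ω < 2.41" (p. 11); Coppersmith–Winograd 1990 §6.
[CohnKleinbergSzegedyUmans2005]
-/

noncomputable section

open Literature.Computability.AlgebraicComplexity

namespace Summit.MatrixMultiplication.OmegaCensus

/-- **Every rate of local USPs bounds `ω` through the CW chart:** for `0 < C < 3/2^{2/3}` and `m ≥ 4`,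
`ω ≤ 3 (log m − log C)/log(m − 2)` (a local USP of width `k ≥ 1` with `s ≥ C^k` rows exists by
`exists_localUSP_card_ge_pow`; feed it to `omega_le_of_isLocalUSP` and use `log s ≥ k log C`).
[cite: CohnKleinbergSzegedyUmans2005, Thm. 37 and §6.2–6.3 (p. 11)] -/
theorem omega_le_of_localUSP_rate {C : ℝ} (hC0 : 0 < C) (hC : C < 3 / (2 : ℝ) ^ (2 / 3 : ℝ)) {m : ℕ}
    (hm : 4 ≤ m) :
    omega ℂ ≤ 3 * (Real.log m - Real.log C) / Real.log ((m : ℝ) - 2) := by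
  obtain ⟨k, hk1, s, row, hloc, hs⟩ := exists_localUSP_card_ge_pow C hC0 hC 1
  have hk : 0 < k := hk1
  have hCk : 0 < C ^ k := pow_pos hC0 k
  have hsR : (0 : ℝ) < s := lt_of_lt_of_le hCk hs
  have hspos : 0 < s := by exact_mod_cast hsR
  have hω := omega_le_of_isLocalUSP hloc hspos hk hm
  have hkR : (0 : ℝ) < k := by exact_mod_cast hk
  have hm2 : (1 : ℝ) < (m : ℝ) - 2 := by
    have : (4 : ℝ) ≤ (m : ℝ) := by exact_mod_cast hm
    linarith
  have hlog2 : 0 < Real.log ((m : ℝ) - 2) := Real.log_pos hm2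
  have hden : 0 < (k : ℝ) * Real.log ((m : ℝ) - 2) := mul_pos hkR hlog2
  have hlogs : (k : ℝ) * Real.log C ≤ Real.log s := by
    rw [← Real.log_pow]; exact Real.log_le_log hCk hs
  calc omega ℂ ≤ 3 * ((k : ℝ) * Real.log m - Real.log s) / ((k : ℝ) * Real.log ((m : ℝ) - 2)) := hω
    _ ≤ 3 * ((k : ℝ) * Real.log m - (k : ℝ) * Real.log C) / ((k : ℝ) * Real.log ((m : ℝ) - 2)) := by
        apply div_le_div_of_nonneg_right _ hden.le
        linarith
    _ = 3 * (Real.log m - Real.log C) / Real.log ((m : ℝ) - 2) := by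
        rw [← mul_sub, ← mul_assoc, mul_comm (3 : ℝ) (k : ℝ), mul_assoc,
          mul_div_mul_left _ _ hkR.ne']

/-- **CKSU 2005, §6.2–6.3 with Theorem 13: the CW-chart bound at the USP capacity.**  For every `m ≥ 4`,
`ω ≤ 3 (log m − log(3/2^{2/3}))/log(m − 2)` — the limit `C → 3/2^{2/3}` of `omega_le_of_localUSP_rate`
(if `ω` exceeded the right-hand side by `ε`, the rate `C = (3/2^{2/3}) e^{−ε log(m−2)/6}` would already
contradict it). [cite: CohnKleinbergSzegedyUmans2005, Thm. 13, Thm. 37 and §6.3 ("this example achieves ω < 2.41")] -/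
theorem omega_le_cksu_uspChart {m : ℕ} (hm : 4 ≤ m) :
    omega ℂ ≤ 3 * (Real.log m - Real.log (3 / (2 : ℝ) ^ (2 / 3 : ℝ))) / Real.log ((m : ℝ) - 2) := by
  set c₀ : ℝ := 3 / (2 : ℝ) ^ (2 / 3 : ℝ) with hc₀
  have hc₀pos : 0 < c₀ := by positivity
  have hm2 : (1 : ℝ) < (m : ℝ) - 2 := by
    have : (4 : ℝ) ≤ (m : ℝ) := by exact_mod_cast hm
    linarith
  set d : ℝ := Real.log ((m : ℝ) - 2) with hd
  have hdpos : 0 < d := Real.log_pos hm2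
  by_contra hlt
  push Not at hlt
  set ε : ℝ := omega ℂ - 3 * (Real.log m - Real.log c₀) / d with hε
  have hεpos : 0 < ε := by rw [hε]; linarith
  set δ : ℝ := ε * d / 6 with hδ
  have hδpos : 0 < δ := by positivity
  set C : ℝ := c₀ * Real.exp (-δ) with hC
  have hCpos : 0 < C := by positivity
  have hClt : C < c₀ := by
    have : Real.exp (-δ) < 1 := Real.exp_lt_one_iff.2 (by linarith)
    calc C = c₀ * Real.exp (-δ) := rfl
      _ < c₀ * 1 := mul_lt_mul_of_pos_left this hc₀pos
      _ = c₀ := mul_one _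
  have hω := omega_le_of_localUSP_rate hCpos hClt hm
  have hlogC : Real.log C = Real.log c₀ - δ := by
    rw [hC, Real.log_mul hc₀pos.ne' (Real.exp_pos _).ne', Real.log_exp]; ring
  rw [hlogC] at hω
  -- `ω ≤ 3 (log m − log c₀ + δ)/d = (ω − ε) + ε/2`
  have : 3 * (Real.log m - (Real.log c₀ - δ)) / d = 3 * (Real.log m - Real.log c₀) / d + ε / 2 := by
    rw [hδ]; field_simp; ring
  rw [this] at hω
  linarith

/-- **The `m = 10` instance** (CKSU's "this example achieves `ω < 2.41`"): `ω ≤ 3 (log 10 − log(3/2^{2/3}))/log 8`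
— numerically `log₈((10 · 2^{2/3}/3)³) = log₈(4000/27) = 2.4036322608…`, the census value R26.  (The same NUMBER
is the tree's `omega_le_logb_eight` / `BCS1997_cor1543 : ω < 2.41` by the laser route, `CwEasyOmegaBound.lean`;
here it is reached inside the Cohn–Umans framework.) [cite: CohnKleinbergSzegedyUmans2005, §6.3 (p. 11, "this example achieves ω < 2.41")] -/
theorem omega_le_cksu_uspChart_ten :
    omega ℂ ≤ 3 * (Real.log 10 - Real.log (3 / (2 : ℝ) ^ (2 / 3 : ℝ))) / Real.log 8 := by
  have h := omega_le_cksu_uspChart (m := 10) (by norm_num)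
  have h8 : ((10 : ℕ) : ℝ) - 2 = 8 := by norm_num
  have h10 : ((10 : ℕ) : ℝ) = 10 := by norm_num
  rw [h8, h10] at h
  exact h

/-- Decimal form: **`ω ≤ 2.4037`** through the group-theoretic route: `3 (log 10 − log(3/2^{2/3})) =
log(4000/27)` and `log(4000/27)/log 8 < 2.4037` since `4000^10000 < 27^10000 · 8^24037` (`decide` in the
kernel). [cite: CohnKleinbergSzegedyUmans2005, §6.3 (p. 11)] -/
theorem omega_le_cksu_chart_decimal : omega ℂ ≤ 2.4037 := by
  have h := omega_le_cksu_uspChart_ten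
  have hc : 3 * (Real.log 10 - Real.log (3 / (2 : ℝ) ^ (2 / 3 : ℝ))) = Real.log (4000 / 27) := by
    have h2 : (0 : ℝ) < (2 : ℝ) ^ (2 / 3 : ℝ) := by positivity
    rw [← Real.log_div (by norm_num) (by positivity), show (3 : ℝ) = ((3 : ℕ) : ℝ) by norm_num,
      ← Real.log_pow]
    congr 1
    rw [div_div_eq_mul_div, div_pow, mul_pow, ← Real.rpow_mul_natCast (by norm_num : (0 : ℝ) ≤ 2)]
    norm_num
  rw [hc, Real.log_div_log] at h
  have hlt : Real.logb 8 (4000 / 27) < 2.4037 := by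
    rw [Real.logb_lt_iff_lt_rpow (by norm_num) (by norm_num)]
    -- `4000/27 < 8^2.4037` ⟸ `(4000/27)^10000 < (8^2.4037)^10000 = 8^24037`
    have key : ((4000 : ℝ) / 27) ^ 10000 < ((8 : ℝ) ^ (2.4037 : ℝ)) ^ 10000 := by
      rw [← Real.rpow_mul_natCast (by norm_num : (0 : ℝ) ≤ 8)]
      rw [show (2.4037 : ℝ) * (10000 : ℕ) = ((24037 : ℕ) : ℝ) by norm_num, Real.rpow_natCast]
      rw [div_pow, div_lt_iff₀ (by positivity)]
      exact_mod_cast (by decide +kernel : (4000 : ℕ) ^ 10000 < 8 ^ 24037 * 27 ^ 10000)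
    exact lt_of_pow_lt_pow_left₀ 10000 (by positivity) key
  exact h.trans hlt.le

end Summit.MatrixMultiplication.OmegaCensus

end
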